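import Summits.KontsevichZagierPeriods.Zeta5Search.Certificates.TwoTaleOmegaRuleLegit

/-!
# ζ(2) two-tale line — `g ≥ b + 7` on the rule domain of direction `a` (cell `pub-zeta5`, fam-tele gen 6 DESIGN snippet; a prover files)

HONEST FRAMING: systematic search; recurrence certificates; no irrationality claim unless certified.

Answer to cert-1 g4's legitimacy question (HOME/INBOX 13:46Z; `certs/tele/bmiss_general/PROOF.md` §4.1): the second-tale `a`-step of
`TwoTaleOmega/StepAR.recR_a` / `StepA.rec_a` carries the hypothesis `b + 4 ≤ g` (common node `−(a+3)`).  On the RULE legitimacy set of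
direction `a` (`TwoTaleOmegaRuleLegit.LegitSet Cert dirA`: the target `p₀ + 3·a` has rule `a` — rules `g, b, e, f` inapplicable — and `a ≥ 17`)
this hypothesis is a THEOREM: `TwoTaleOmegaRules.gb_bounds` gives `g ≤ a+3` and `b ≤ a + 3 − min(e,f)` at the target, and `Ω` gives `g ≥ a+1`,
`2·min(e,f) ≥ a+1`, hence `g − b ≥ min(e,f) − 2 ≥ ⌈(a+1)/2⌉ − 2 ≥ 7`.  So the hypothesis `hLeg` of cert-1's plug-in `StepA.hstepA_U1/U0` is
discharged for the legitimacy predicate of the final assembly (`fun δ p₀ => p₀ ∈ LegitSet Cert δ`, any `Cert`) — no change to the rule, no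
coverage re-run, the 1908-point base table unaffected.  Linear arithmetic only.
-/

namespace Summit.KontsevichZagierPeriods.Zeta5Search.Certificates

namespace TwoTaleTelescope

/-- LEMMA G of PROOF.md §4.1: at every `p ∈ Ω` at which rule `b` is inapplicable, `g − b ≥ min(e,f) − 2` — no restriction on `a`,
rule `a` not needed. -/
theorem gap_of_not_app_B (p : Pt) (hp : p ∈ Omega) (hb : p ∉ App dirB) : p 1 + p 2 ≤ p 4 + 2 ∨ p 1 + p 3 ≤ p 4 + 2 := by
  have h2 := not_app_B p hp hb
  rw [mem_Omega] at hp
  omega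

/-- Hence on the whole rule domain of direction `a` (any `a`; the domain is empty for `a ≤ 8`): `2(g − b) ≥ a − 3`, i.e.
`g − b ≥ ⌈(a+1)/2⌉ − 2` — so `g − b ≥ 4` as soon as `a ≥ 11`; the only rule-`a` targets with `g − b = 3` are `(9,7,5,6,10)`, `(9,7,6,5,10)`
(PROOF.md §5: exactly the two `base:invalid-a` EXC points). -/
theorem ruleDomA_gap (p : Pt) (hr : p ∈ RuleDom dirA) : p 0 ≤ 2 * (p 4 - p 1) + 3 := by
  rw [ruleDom_A] at hr
  obtain ⟨hA, -, hb, -, -⟩ := hr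
  have hp : p ∈ Omega := by simpa using hA 0 (Nat.zero_le _)
  have hgap := gap_of_not_app_B p hp hb
  rw [mem_Omega] at hp
  omega

/-- On the rule domain of direction `a`, for a target with `a ≥ 17`: `b + 7 ≤ g` (PROOF.md §4.1: `g − b ≥ min(e,f) − 2 ≥ ⌈(a+1)/2⌉ − 2`). -/
theorem ruleDomA_gb (p : Pt) (hr : p ∈ RuleDom dirA) (h17 : 17 ≤ p 0) : p 1 + 7 ≤ p 4 := by
  rw [ruleDom_A] at hr
  obtain ⟨hA, hg, hb, -, -⟩ := hr
  have hp : p ∈ Omega := by simpa using hA 0 (Nat.zero_le _)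
  have hgb := gb_bounds p hp h17 hg hb
  rw [mem_Omega] at hp
  omega

/-- Hence the hypothesis `hLeg : ∀ p₀, Legit dirA p₀ → p₀ 1 + 4 ≤ p₀ 4` of cert-1's `TwoTaleOmega.Pt.hstepA_U1/U0` holds for the RULE
legitimacy predicate `Legit := fun δ p₀ => p₀ ∈ LegitSet Cert δ` (any certificate predicate `Cert`). -/
theorem legitSet_dirA_gb (Cert : Pt → Set Pt) (p₀ : Pt) (h : p₀ ∈ LegitSet Cert dirA) : p₀ 1 + 4 ≤ p₀ 4 := by
  obtain ⟨hr, -, h17⟩ := h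
  have h7 := ruleDomA_gb _ hr (h17 (Or.inl rfl))
  have e1 : (p₀ + (3 : ℤ) • dirA) 1 = p₀ 1 := by simp [dirA]
  have e4 : (p₀ + (3 : ℤ) • dirA) 4 = p₀ 4 := by simp [dirA]
  rw [e1, e4] at h7
  omega

/-- The same bound from the ABSTRACT hypothesis `hA` of cert-2's `TwoTaleOmegaAefTable.eq_on_Omega_all` at a certified base point
(the target `p₀ + 3·a ∈ Ω` comes from `StepBase`). -/
theorem stepBase_dirA_gb (Legit : Pt → Pt → Prop)
    (hA : ∀ p₀, Legit dirA p₀ → 17 ≤ p₀ 0 + 3 ∧ p₀ + (3 : ℤ) • dirA ∉ App dirG ∧ p₀ + (3 : ℤ) • dirA ∉ App dirB)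
    (p₀ : Pt) (hst : p₀ ∈ StepBase Legit dirA) : p₀ 1 + 7 ≤ p₀ 4 := by
  obtain ⟨-, hΩ, hleg⟩ := hst
  obtain ⟨h17, hg, hb⟩ := hA p₀ hleg
  have hp : p₀ + (3 : ℤ) • dirA ∈ Omega := by simpa using hΩ 3 le_rfl
  have e0 : (p₀ + (3 : ℤ) • dirA) 0 = p₀ 0 + 3 := by simp [dirA]
  have e1 : (p₀ + (3 : ℤ) • dirA) 1 = p₀ 1 := by simp [dirA]
  have e2 : (p₀ + (3 : ℤ) • dirA) 2 = p₀ 2 := by simp [dirA]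
  have e3 : (p₀ + (3 : ℤ) • dirA) 3 = p₀ 3 := by simp [dirA]
  have e4 : (p₀ + (3 : ℤ) • dirA) 4 = p₀ 4 := by simp [dirA]
  have hgb := gb_bounds _ hp (by omega) hg hb
  rw [mem_Omega] at hp
  rw [e0, e1, e2, e3, e4] at hp hgb
  omega

end TwoTaleTelescope

end Summit.KontsevichZagierPeriods.Zeta5Search.Certificates
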